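import Summits.SmoothPoincare4.SmoothPoincare4.Theorems.ConvexBisectionAcyclicBisectionExistsDualSignPin
import Summits.SmoothPoincare4.SmoothPoincare4.Theorems.ConvexBisectionAcyclicBisectionExistsOrseamSeamFrames
import Literature.Topology.FourManifolds.OrientedConnectedSumTransportProofs
import HarnessLib

/-!
# Dual handles, SIGN-PIN + ORSEAM: the page presentation of the complement piece with twisting `-1`
# and one positively oriented pair of seam frames
(sub-goals SIGN-PIN + ORSEAM of stub `stub_T3_dualPresentation` (T3), line `modp-braid-orbits` r12, crux
`ConvexBisection.AcyclicBisectionExists`, item stmt-SmoothPoincare4-10508; wave 5, lead c5, worker X4;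
registered sub-goal `helper_dualPresentation_signPin`)

Sequel of `…DualSignPin.lean` (re-reading a page presentation through `σ = baseReflection g`: data,
pages, shadows, twisting negated), `…OrseamFrame.lean` (`det4` calculus; a negative tangent frame becomes
a positive frame of the `σ`-transported presentation) and `…OrseamSeamFrames.lean` (corresponding frames
at a seam point; positive frames).  Here the assembly **`dualPresentation_signPin`**
(= `helper_dualPresentation_signPin`, the X4 → X2 interface `HsignStatement`): from a page presentation
`(q₂, D₂)` of `W₂` over the cap with twisting `if s then -1 else 1` (T3c-3), a seam point unsurgered on
both sides, and the ORIENTATION CHARACTER hypothesis `Hχ` (corresponding frames: side 1 positive ⇒ side 2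
has sign `if s then + else −`; this is ST4's global sign `s₀` in `det4` form — ONE orientation character
governs the twisting sign and the frame sign), produce `τ ∈ {id, σ}` and the `τ`-transported presentation
`h₂ j = (q₂ j).transport τ` with data `D₂''` (`D₂''.jA = D₂.jA ∘ τ`, `D₂''.jB = D₂.jB`), pages, shadows
`≠ 0`, twisting `-1` (T3 clause (i)) AND T3 clause (iv) ORSEAM verbatim; with `w ∘ τ = w`,
`rho ∘ τ = rho`, `τ ∘ τ = id` exported for the transfer of T3 clauses (ii)/(iii).

Everything is proved; no named facts, no `sorry`.

## References
* R. İ. Baykur, *Kähler decomposition of 4-manifolds*, AGT 6 (2006), §2.3 and proof of Thm. 5.1,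
  pp. 13–14. [Baykur2006]
* J. M. Lee, *Introduction to Smooth Manifolds* (2013), Thm. 5.11, Prop. 15.24. [LeeSmoothManifolds2013]
-/

noncomputable section

-- the prescribed namespace `Summit.<P>.<Sub>.…` duplicates `SmoothPoincare4` (P = Sub)
set_option linter.dupNamespace false

open scoped Manifold ContDiff Topology RealInnerProductSpace

namespace Summit.SmoothPoincare4.SmoothPoincare4.Theorems.AcyclicBisectionExists.ModpBraidOrbits

open Set Function Metric Module
open Literature.Topology.FourManifolds Literature.Topology.FourManifolds.HandleAttachingMap
  Literature.Topology.FourManifolds.BoundaryManifold Literature.Topology.FourManifolds.LefschetzBase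
  Literature.Geometry.Symplectic Literature.Geometry.Manifold

/-! ## §3 SIGN-PIN + ORSEAM -/

section Main

/-- **SIGN-PIN + ORSEAM (the X4 → X2 interface `HsignStatement`).**  Let `(q₁, X₁, D₁, b₁)` be a
presentation of the first piece over the cap `Base g`, `(W₂, b₂, φ)` the second piece glued along
`φ : ∂X₁ ≅ ∂W₂`, and `(q₂, D₂)` a page presentation of `W₂` over the cap with pages, shadows `≠ 0` and
page twisting `if s then -1 else 1` (T3c-3's output); let `y₀` be a seam point unsurgered on both sides
(`b₁.incl y₀ = D₁.jA a₁`, `b₂.incl (φ y₀) = D₂.jA a₂`) at which the seam correspondence has orientation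
character `if s then +1 else -1` (`Hχ`: for every triple of corresponding frames, side 1 positive ⇒
side 2 has that sign — ST4's global sign in `det4` form).  Then for `τ := id` (`s = true`) or `τ := σ`
(`s = false`, the fibred orientation-reversing involution `baseReflection g`) the `τ`-transported
presentation `h₂ j = (q₂ j).transport τ` with data `D₂''` (`D₂''.jA = D₂.jA ∘ τ`, `D₂''.jB = D₂.jB`)
has its attaching circles in pages, non-zero shadows and page twisting `-1` — T3 clause (i) — and T3
clause (iv) ORSEAM holds: at `y₀` a positive frame of side 1 corresponds to a positive frame of side 2
(kept for `τ = id`; for `τ = σ` the negative side-2 frame `v₂` becomes the positive frame `dσ(v₂)` at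
`σ a₂`, `…OrseamFrame.lean`).  ONE orientation character governs both signs. [cite: Baykur2006, Thm. 5.1 (proof, pp. 13–14)] -/
theorem dualPresentation_signPin :
    ∀ (g : ℕ) (ι₁ ι₂ : Type) [Finite ι₁] [Finite ι₂]
      (q₁ : ι₁ → Literature.Topology.FourManifolds.HandleAttachingMap 3 2
        (Literature.Topology.FourManifolds.LefschetzBase.Base g))
      (X₁ : Type) [TopologicalSpace X₁] [T2Space X₁] [ChartedSpace (EuclideanHalfSpace 4) X₁]
      [IsManifold (𝓡∂ 4) ∞ X₁]
      (D₁ : Literature.Topology.FourManifolds.HandleAttachingMap.MultiAttachmentData q₁ (𝓡∂ 4) X₁)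
      (b₁ : Literature.Topology.FourManifolds.BoundaryData (𝓡∂ 4) X₁ (𝓡 3))
      (W₂ : Type) [TopologicalSpace W₂] [T2Space W₂] [ChartedSpace (EuclideanHalfSpace 4) W₂]
      [IsManifold (𝓡∂ 4) ∞ W₂]
      (b₂ : Literature.Topology.FourManifolds.BoundaryData (𝓡∂ 4) W₂ (𝓡 3))
      (φ : b₁.carrier ≃ₘ⟮𝓡 3, 𝓡 3⟯ b₂.carrier)
      (q₂ : ι₂ → Literature.Topology.FourManifolds.HandleAttachingMap 3 2
        (Literature.Topology.FourManifolds.LefschetzBase.Base g))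
      (D₂ : Literature.Topology.FourManifolds.HandleAttachingMap.MultiAttachmentData q₂ (𝓡∂ 4) W₂)
      (s : Bool),
      (∀ j, ∃ c : ℂ, ‖c‖ = 1 ∧ ∀ θ, (q₂ j).attachingCircle θ ∈
        Literature.Topology.FourManifolds.LefschetzBase.page g c) →
      (∀ j, Literature.Topology.FourManifolds.LefschetzBase.shadow g (q₂ j).attachingCircle
        (q₂ j).continuous_attachingCircle ≠ 0) →
      (∀ j, Literature.Topology.FourManifolds.LefschetzBase.pageTwisting g (q₂ j).attachingCircle
        (q₂ j).attachingFraming = if s then -1 else 1) →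
      ∀ (y₀ : b₁.carrier)
        (a₁ : Literature.Topology.FourManifolds.HandleAttachingMap.coresComplement q₁)
        (a₂ : Literature.Topology.FourManifolds.HandleAttachingMap.coresComplement q₂),
      b₁.incl y₀ = D₁.jA a₁ → b₂.incl (φ y₀) = D₂.jA a₂ →
      -- Hχ : orientation character of the seam at `y₀` is `if s then +1 else -1`
      (∀ (uu : Fin 3 → EuclideanSpace ℝ (Fin 3)) (v₁ v₂ : Fin 3 → EuclideanSpace ℝ (Fin 4)),
        (∀ k, mfderiv (𝓡 3) (𝓡∂ 4) b₁.incl y₀ (uu k) = mfderiv (𝓡∂ 4) (𝓡∂ 4) D₁.jA a₁ (v₁ k)) →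
        (∀ k, mfderiv (𝓡 3) (𝓡∂ 4) (b₂.incl ∘ φ) y₀ (uu k) = mfderiv (𝓡∂ 4) (𝓡∂ 4) D₂.jA a₂ (v₂ k)) →
        Literature.Geometry.Symplectic.IsPosBdryFrame q₁ a₁ v₁ →
        0 < (if s then (1 : ℝ) else -1) *
          Literature.Geometry.Symplectic.det4
            (gradient (Literature.Topology.FourManifolds.LefschetzBase.rho g) (a₂ : _root_.Literature.Topology.FourManifolds.LefschetzBase.Base g).1)
            (Literature.Geometry.Symplectic.ambientC q₂ a₂ (v₂ 0))
            (Literature.Geometry.Symplectic.ambientC q₂ a₂ (v₂ 1))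
            (Literature.Geometry.Symplectic.ambientC q₂ a₂ (v₂ 2))) →
      ∃ (τ : Literature.Topology.FourManifolds.LefschetzBase.Base g ≃ₘ⟮𝓡∂ 4, 𝓡∂ 4⟯
          Literature.Topology.FourManifolds.LefschetzBase.Base g)
        (h₂ : ι₂ → Literature.Topology.FourManifolds.HandleAttachingMap 3 2
          (Literature.Topology.FourManifolds.LefschetzBase.Base g))
        (D₂'' : Literature.Topology.FourManifolds.HandleAttachingMap.MultiAttachmentData h₂ (𝓡∂ 4) W₂),
        -- τ is `Diffeomorph.refl` or V3's `baseReflection g`; what X5/X6 need about it: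
        (∀ x, Literature.Topology.FourManifolds.LefschetzBase.w g (τ x).1 =
          Literature.Topology.FourManifolds.LefschetzBase.w g x.1) ∧
        (∀ x, Literature.Topology.FourManifolds.LefschetzBase.rho g (τ x).1 =
          Literature.Topology.FourManifolds.LefschetzBase.rho g x.1) ∧
        (∀ x, τ (τ x) = x) ∧
        (∀ j, h₂ j = (q₂ j).transport τ) ∧
        (∀ (a : Literature.Topology.FourManifolds.HandleAttachingMap.coresComplement h₂)
          (a' : Literature.Topology.FourManifolds.HandleAttachingMap.coresComplement q₂),
          (a' : Literature.Topology.FourManifolds.LefschetzBase.Base g) = τ a → D₂''.jA a = D₂.jA a') ∧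
        (∀ i b, D₂''.jB i b = D₂.jB i b) ∧
        -- T3 clause (i)
        (∀ j, ∃ c : ℂ, ‖c‖ = 1 ∧ ∀ θ, (h₂ j).attachingCircle θ ∈
          Literature.Topology.FourManifolds.LefschetzBase.page g c) ∧
        (∀ j, Literature.Topology.FourManifolds.LefschetzBase.shadow g (h₂ j).attachingCircle
          (h₂ j).continuous_attachingCircle ≠ 0) ∧
        (∀ j, Literature.Topology.FourManifolds.LefschetzBase.pageTwisting g (h₂ j).attachingCircle
          (h₂ j).attachingFraming = -1) ∧
        -- T3 clause (iv) ORSEAM, verbatim shape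
        (∃ (y : b₁.carrier) (a₁ : Literature.Topology.FourManifolds.HandleAttachingMap.coresComplement q₁)
            (a₂ : Literature.Topology.FourManifolds.HandleAttachingMap.coresComplement h₂)
            (uu : Fin 3 → EuclideanSpace ℝ (Fin 3)) (v₁ v₂ : Fin 3 → EuclideanSpace ℝ (Fin 4)),
          b₁.incl y = D₁.jA a₁ ∧ b₂.incl (φ y) = D₂''.jA a₂ ∧
          (∀ k, mfderiv (𝓡 3) (𝓡∂ 4) b₁.incl y (uu k) = mfderiv (𝓡∂ 4) (𝓡∂ 4) D₁.jA a₁ (v₁ k)) ∧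
          (∀ k, mfderiv (𝓡 3) (𝓡∂ 4) (b₂.incl ∘ φ) y (uu k) = mfderiv (𝓡∂ 4) (𝓡∂ 4) D₂''.jA a₂ (v₂ k)) ∧
          Literature.Geometry.Symplectic.IsPosBdryFrame q₁ a₁ v₁ ∧
          Literature.Geometry.Symplectic.IsPosBdryFrame h₂ a₂ v₂) := by
  intro g ι₁ ι₂ _ _ q₁ X₁ _ _ _ _ D₁ b₁ W₂ _ _ _ _ b₂ φ q₂ D₂ s hpage hsh htw y₀ a₁ a₂ h₁ h₂ Hχ
  obtain ⟨-, ha₁⟩ := rho_eq_of_incl_eq_jA D₁ b₁ h₁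
  obtain ⟨-, ha₂⟩ := rho_eq_of_incl_eq_jA D₂ b₂ h₂
  obtain ⟨v₁, hv₁, hpos₁⟩ := exists_isPosBdryFrame q₁ a₁ ha₁
  obtain ⟨uu, v₂, hF1, hF2, hv₂⟩ := exists_seamFrames D₁ b₁ D₂ b₂ φ y₀ a₁ a₂ h₁ h₂ v₁ hv₁
  have hχ := Hχ uu v₁ v₂ hF1 hF2 hpos₁
  cases s with
  | true =>
    simp only [if_true, one_mul] at hχ htw
    refine ⟨Diffeomorph.refl (𝓡∂ 4) (Base g) ∞, q₂, D₂, fun x => rfl, fun x => rfl, fun x => rfl,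
      fun j => (transport_refl (q₂ j)).symm, ?_, fun i b => rfl, hpage, hsh, htw,
      ⟨y₀, a₁, a₂, uu, v₁, v₂, h₁, h₂, hF1, hF2, hpos₁, hχ⟩⟩
    intro a a' h
    have : a' = a := Subtype.ext h
    rw [this]
  | false =>
    simp only [Bool.false_eq_true, if_false, neg_mul, one_mul] at hχ htw
    have hneg : det4 (gradient (rho g) (a₂ : Base g).1) (ambientC q₂ a₂ (v₂ 0)) (ambientC q₂ a₂ (v₂ 1))
        (ambientC q₂ a₂ (v₂ 2)) < 0 := by linarith
    obtain ⟨D'', hA, hB, hpage', hsh', htw'⟩ :=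
      helper_pagePresentation_baseReflection g ι₂ q₂ W₂ D₂ 1 hpage hsh htw
    have ha₂' : baseReflection g a₂ ∈ coresComplement fun i => (q₂ i).transport (baseReflection g) := by
      rw [mem_coresComplement_transport_iff, baseReflection_symm, baseReflection_baseReflection]
      exact a₂.2
    set a₂'' : ↥(coresComplement fun i => (q₂ i).transport (baseReflection g)) :=
      ⟨baseReflection g a₂, ha₂'⟩ with ha₂''
    have hcongr : coresComplementCongr q₂ (baseReflection g) a₂'' = a₂ := by
      apply Subtype.ext
      rw [coe_coresComplementCongr, baseReflection_symm]
      exact baseReflection_baseReflection _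
    refine ⟨baseReflection g, fun i => (q₂ i).transport (baseReflection g), D'', w_baseReflection,
      rho_baseReflection, baseReflection_baseReflection, fun j => rfl, ?_, hB, hpage', hsh',
      by simpa using htw', ?_⟩
    · intro a a' h
      rw [hA a]
      congr 1
      apply Subtype.ext
      rw [coe_coresComplementCongr, baseReflection_symm]
      exact h.symm
    · refine ⟨y₀, a₁, a₂'', uu, v₁,
        fun k => mfderiv (𝓡∂ 4) (𝓡∂ 4) (baseReflection g) (a₂ : Base g) (v₂ k), h₁, ?_, hF1, ?_, hpos₁,
        isPosBdryFrame_transport_baseReflection q₂ a₂ ha₂ v₂ hv₂ hneg ha₂'⟩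
      · rw [hA, hcongr]; exact h₂
      · intro k
        rw [hF2 k]
        have hfun : D''.jA = D₂.jA ∘ coresComplementCongr q₂ (baseReflection g) := funext hA
        rw [hfun]
        have hC : MDifferentiableAt (𝓡∂ 4) (𝓡∂ 4) (coresComplementCongr q₂ (baseReflection g)) a₂'' :=
          (coresComplementCongr q₂ (baseReflection g)).contMDiff.mdifferentiableAt (by simp)
        have hJ : MDifferentiableAt (𝓡∂ 4) (𝓡∂ 4) D₂.jA (coresComplementCongr q₂ (baseReflection g) a₂'') :=
          mdifferentiableAt_jA D₂ _
        rw [mfderiv_comp a₂'' hJ hC]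
        have hcd : mfderiv (𝓡∂ 4) (𝓡∂ 4) (coresComplementCongr q₂ (baseReflection g)) a₂'' =
            mfderiv (𝓡∂ 4) (𝓡∂ 4) (baseReflection g) (baseReflection g (a₂ : Base g)) := by
          rw [mfderiv_opens_eq (f := ((baseReflection g).symm : Base g → Base g))
            (g := coresComplementCongr q₂ (baseReflection g))
            (fun y => coe_coresComplementCongr q₂ (baseReflection g) y)
            ((baseReflection g).symm.contMDiff.mdifferentiableAt (by simp))]
          rfl
        rw [hcd, hcongr]
        have hσσ : mfderiv (𝓡∂ 4) (𝓡∂ 4) (baseReflection g) (baseReflection g (a₂ : Base g))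
            (mfderiv (𝓡∂ 4) (𝓡∂ 4) (baseReflection g) (a₂ : Base g) (v₂ k)) = v₂ k := by
          have hd1 : MDifferentiableAt (𝓡∂ 4) (𝓡∂ 4) (baseReflection g) (a₂ : Base g) :=
            (baseReflection g).contMDiff.mdifferentiableAt (by simp)
          have hd2 : MDifferentiableAt (𝓡∂ 4) (𝓡∂ 4) (baseReflection g) (baseReflection g (a₂ : Base g)) :=
            (baseReflection g).contMDiff.mdifferentiableAt (by simp)
          have hcomp := mfderiv_comp (a₂ : Base g) hd2 hd1
          have hid : ((baseReflection g) ∘ (baseReflection g) : Base g → Base g) = id :=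
            funext baseReflection_baseReflection
          rw [hid, mfderiv_id] at hcomp
          have := congrArg (fun L : EuclideanSpace ℝ (Fin 4) →L[ℝ] EuclideanSpace ℝ (Fin 4) => L (v₂ k)) hcomp
          exact this.symm
        show _ = (mfderiv (𝓡∂ 4) (𝓡∂ 4) D₂.jA a₂)
          (mfderiv (𝓡∂ 4) (𝓡∂ 4) (baseReflection g) (baseReflection g (a₂ : Base g))
            (mfderiv (𝓡∂ 4) (𝓡∂ 4) (baseReflection g) (a₂ : Base g) (v₂ k)))
        rw [hσσ]

end Main

/-! ## §4 The registered package -/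

/-- **Sub-goal `helper_dualPresentation_signPin` of stub `stub_T3_dualPresentation`** (T3 ▸ SIGN-PIN +
ORSEAM; wave 5, lead c5, worker X4; the X4 → X2 interface `HsignStatement`, one line): from T3c-3's page
presentation of the complement piece with twisting `if s then -1 else 1`, a seam point unsurgered on
both sides and the orientation character `if s then +1 else -1` of the seam correspondence there (ST4's
global sign in `det4` form), the `τ`-transported presentation (`τ = id` or the fibred orientation-reversing
involution `σ = baseReflection g`) has pages, non-zero shadows, page twisting `-1` (T3 clause (i)) and one
positively oriented pair of corresponding seam frames (T3 clause (iv) ORSEAM), with `w ∘ τ = w`,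
`rho ∘ τ = rho`, `τ ∘ τ = id`, `D₂''.jA = D₂.jA ∘ τ`, `D₂''.jB = D₂.jB` for the transfer of the other
clauses. [cite: Baykur2006, Thm. 5.1 (proof, pp. 13–14)] -/
theorem helper_dualPresentation_signPin : ∀ (g : ℕ) (ι₁ ι₂ : Type) [Finite ι₁] [Finite ι₂] (q₁ : ι₁ → Literature.Topology.FourManifolds.HandleAttachingMap 3 2 (Literature.Topology.FourManifolds.LefschetzBase.Base g)) (X₁ : Type) [TopologicalSpace X₁] [T2Space X₁] [ChartedSpace (EuclideanHalfSpace 4) X₁] [IsManifold (𝓡∂ 4) ∞ X₁] (D₁ : Literature.Topology.FourManifolds.HandleAttachingMap.MultiAttachmentData q₁ (𝓡∂ 4) X₁) (b₁ : Literature.Topology.FourManifolds.BoundaryData (𝓡∂ 4) X₁ (𝓡 3)) (W₂ : Type) [TopologicalSpace W₂] [T2Space W₂] [ChartedSpace (EuclideanHalfSpace 4) W₂] [IsManifold (𝓡∂ 4) ∞ W₂] (b₂ : Literature.Topology.FourManifolds.BoundaryData (𝓡∂ 4) W₂ (𝓡 3)) (φ : b₁.carrier ≃ₘ⟮𝓡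 3, 𝓡 3⟯ b₂.carrier) (q₂ : ι₂ → Literature.Topology.FourManifolds.HandleAttachingMap 3 2 (Literature.Topology.FourManifolds.LefschetzBase.Base g)) (D₂ : Literature.Topology.FourManifolds.HandleAttachingMap.MultiAttachmentData q₂ (𝓡∂ 4) W₂) (s : Bool), (∀ j, ∃ c : ℂ, ‖c‖ = 1 ∧ ∀ θ, (q₂ j).attachingCircle θ ∈ Literature.Topology.FourManifolds.LefschetzBase.page g c) → (∀ j, Literature.Topology.FourManifolds.LefschetzBase.shadow g (q₂ j).attachingCircle (q₂ j).continuous_attachingCircle ≠ 0) → (∀ j, Literature.Topology.FourManifolds.LefschetzBase.pageTwisting g (q₂ j).attachingCircle (q₂ j).attachingFraming = if s then -1 else 1) → ∀ y₀ a₁ a₂, b₁.incl y₀ = D₁.jA a₁ → b₂.incl (φ y₀) = D₂.jA a₂ → (∀ (uu : Fin 3 → EuclideanSpace ℝ (Fin 3)) (v₁ v₂ : Fin 3 → EuclideanSpace ℝ (Fin 4)), (∀ k, mfderiv (𝓡 3) (𝓡∂ 4) b₁.incl y₀ (uu k) = mfderiv (𝓡∂ 4) (𝓡∂ 4) D₁.jA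 a₁ (v₁ k)) → (∀ k, mfderiv (𝓡 3) (𝓡∂ 4) (b₂.incl ∘ φ) y₀ (uu k) = mfderiv (𝓡∂ 4) (𝓡∂ 4) D₂.jA a₂ (v₂ k)) → Literature.Geometry.Symplectic.IsPosBdryFrame q₁ a₁ v₁ → 0 < (if s then (1 : ℝ) else -1) * Literature.Geometry.Symplectic.det4 (gradient (Literature.Topology.FourManifolds.LefschetzBase.rho g) a₂.1.1) (Literature.Geometry.Symplectic.ambientC q₂ a₂ (v₂ 0)) (Literature.Geometry.Symplectic.ambientC q₂ a₂ (v₂ 1)) (Literature.Geometry.Symplectic.ambientC q₂ a₂ (v₂ 2))) → ∃ (τ : Literature.Topology.FourManifolds.LefschetzBase.Base g ≃ₘ⟮𝓡∂ 4, 𝓡∂ 4⟯ Literature.Topology.FourManifolds.LefschetzBase.Base g) (h₂ : ι₂ → Literature.Topology.FourManifolds.HandleAttachingMap 3 2 (Literature.Topology.FourManifolds.LefschetzBase.Base g)) (D₂'' : Literature.Topology.FourManifolds.HandleAttachingMap.MultiAttachmentData h₂ (𝓡∂ 4) W₂), (∀ x, Literature.Topology.FourManifolds.LefschetzBase.w g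 (τ x).1 = Literature.Topology.FourManifolds.LefschetzBase.w g x.1) ∧ (∀ x, Literature.Topology.FourManifolds.LefschetzBase.rho g (τ x).1 = Literature.Topology.FourManifolds.LefschetzBase.rho g x.1) ∧ (∀ x, τ (τ x) = x) ∧ (∀ j, h₂ j = (q₂ j).transport τ) ∧ (∀ (a : Literature.Topology.FourManifolds.HandleAttachingMap.coresComplement h₂) (a' : Literature.Topology.FourManifolds.HandleAttachingMap.coresComplement q₂), a'.1 = τ a.1 → D₂''.jA a = D₂.jA a') ∧ (∀ i b, D₂''.jB i b = D₂.jB i b) ∧ (∀ j, ∃ c : ℂ, ‖c‖ = 1 ∧ ∀ θ, (h₂ j).attachingCircle θ ∈ Literature.Topology.FourManifolds.LefschetzBase.page g c) ∧ (∀ j, Literature.Topology.FourManifolds.LefschetzBase.shadow g (h₂ j).attachingCircle (h₂ j).continuous_attachingCircle ≠ 0) ∧ (∀ j, Literature.Topology.FourManifolds.LefschetzBase.pageTwisting g (h₂ j).attachingCircle (h₂ j).attachingFraming = -1) ∧ (∃ (y : b₁.carrier) (a₁ : Literature.Topology.FourManifolds.HandleAttachingMap.coresComplement q₁) (a₂ :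 Literature.Topology.FourManifolds.HandleAttachingMap.coresComplement h₂) (uu : Fin 3 → EuclideanSpace ℝ (Fin 3)) (v₁ v₂ : Fin 3 → EuclideanSpace ℝ (Fin 4)), b₁.incl y = D₁.jA a₁ ∧ b₂.incl (φ y) = D₂''.jA a₂ ∧ (∀ k, mfderiv (𝓡 3) (𝓡∂ 4) b₁.incl y (uu k) = mfderiv (𝓡∂ 4) (𝓡∂ 4) D₁.jA a₁ (v₁ k)) ∧ (∀ k, mfderiv (𝓡 3) (𝓡∂ 4) (b₂.incl ∘ φ) y (uu k) = mfderiv (𝓡∂ 4) (𝓡∂ 4) D₂''.jA a₂ (v₂ k)) ∧ Literature.Geometry.Symplectic.IsPosBdryFrame q₁ a₁ v₁ ∧ Literature.Geometry.Symplectic.IsPosBdryFrame h₂ a₂ v₂) :=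
  fun g ι₁ ι₂ _ _ q₁ X₁ _ _ _ _ D₁ b₁ W₂ _ _ _ _ b₂ φ q₂ D₂ s hpage hsh htw y₀ a₁ a₂ h₁ h₂ Hχ =>
    dualPresentation_signPin g ι₁ ι₂ q₁ X₁ D₁ b₁ W₂ b₂ φ q₂ D₂ s hpage hsh htw y₀ a₁ a₂ h₁ h₂ Hχ

end Summit.SmoothPoincare4.SmoothPoincare4.Theorems.AcyclicBisectionExists.ModpBraidOrbits

end
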